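import Mathlib
import Summits.CriticalPhenomena.PercolationContinuityZ3.Theses.PercBurnResprinkle

/-!
# Sketch — crux VacantReignition (stmt-CriticalPhenomena-7203), planner crux-ideate, ideator 2

First-lemma signatures for the idea cards
* `explore-from-infinity`  (resampling identity ⇒ one-field shell form; tightness; contact soup)
* `porosity-not-counting`  (finite-size POROSITY criterion at `p_c` replacing ADKS/GHK arm counting)

Everything is stated over existing declarations (`labelMeasure`, `configOfLabels`, `openCluster`,
`openConnIn`, `bondPercolation`, `criticalProb`, `criticalProbI`, `zdGraph`); nothing is proved here.
-/

namespace Summit.CriticalPhenomena.PercolationContinuityZ3.Cruxes.VacantReignition.Sketch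

open MeasureTheory Literature.Probability.Percolation Literature.Probability.LatticeModels

noncomputable section

/-- The cubic lattice `ℤ³`. -/
abbrev G3 : SimpleGraph (Fin 3 → ℤ) := zdGraph 3
/-- Edge labels. -/
abbrev Lbl : Type := Sym2 (Fin 3 → ℤ) → ℝ

/-- The burnt set `I_p(U)`: vertices whose level-`p` cluster is infinite. -/
def burnt (p : ℝ) (U : Lbl) : Set (Fin 3 → ℤ) :=
  {y | (openCluster (configOfLabels p U G3) y).Infinite}

/-- The vacant configuration at level `q` read from labels `W`, off the burnt set of `(p, U)`:
`W = U′` (fresh) is the route's two-field object, `W = U` (own labels) is the one-field SHELL. -/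
def vacantConfig (p : ℝ) (U : Lbl) (q : ℝ) (W : Lbl) : BondConfig (Fin 3 → ℤ) :=
  {e | e ∈ configOfLabels q W G3 ∧ ∀ y ∈ e, y ∉ burnt p U}

/-! ## Card `explore-from-infinity` -/

/-- FIRST LEMMA (resampling identity, "explore the infinite cluster from infinity"): for all
levels `p, q`, re-sprinkling the vacant set with a FRESH field has the same percolation
probability as raising the environment's OWN water level to `q` off `I_p`.  (Consequence of:
conditionally on `I_p(U)`, the labels `U` on edges with both endpoints off `I_p(U)` are i.i.d.
uniform — finite-volume exploration from `∂Λ_n` is a stopping set, then `n → ∞`.) -/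
def ShellIdentity : Prop :=
  ∀ p q : ℝ,
    (labelMeasure (Fin 3 → ℤ)).real {U | (openCluster (vacantConfig p U q U) 0).Infinite}
      = ((labelMeasure (Fin 3 → ℤ)).prod (labelMeasure (Fin 3 → ℤ))).real
          {π : Lbl × Lbl | (openCluster (vacantConfig p π.1 q π.2) 0).Infinite}

/-- TIGHTNESS COROLLARY (exact, both worlds): on the diagonal `q = p` the fresh field never
percolates off `I_p` — `p_c(ℤ³ ∖ I_p) ≥ p` a.s.; in the one-field form this is the triviality
"the level-`p` clusters off `I_p` are the finite ones", transported by `ShellIdentity`. -/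
def DiagonalVanishes : Prop :=
  ∀ p : ℝ, ((labelMeasure (Fin 3 → ℤ)).prod (labelMeasure (Fin 3 → ℤ))).real
      {π : Lbl × Lbl | (openCluster (vacantConfig p π.1 p π.2) 0).Infinite} = 0

/-- ONE-FIELD (SHELL) FORM of the crux: the `(p, p_c+ε]`-shell of the infinite cluster,
i.e. the level-`(p_c+ε)`-open edges with both endpoints outside the level-`p` core `I_p`,
percolates from the origin with positive probability, for some `p > p_c`. -/
def ShellReignition : Prop :=
  ∀ ε : ℝ, 0 < ε → ∃ p : ℝ, criticalProb G3 0 < p ∧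
    0 < (labelMeasure (Fin 3 → ℤ)).real
      {U | (openCluster (vacantConfig p U (criticalProb G3 0 + ε) U) 0).Infinite}

/-- The transfer is literal: under `ShellIdentity` the shell form IS the route's crux. -/
def ShellTransfer : Prop :=
  ShellIdentity → (ShellReignition ↔ Theses.PercBurnResprinkle.VacantReignition)

/-- sup-distance on `ℤ³`. -/
def supDist (x y : Fin 3 → ℤ) : ℤ :=
  Finset.univ.sup' Finset.univ_nonempty fun i => |x i - y i|

/-- The sup-norm cube of radius `n` about `c`. -/
def cube (c : Fin 3 → ℤ) (n : ℕ) : Set (Fin 3 → ℤ) := {y | supDist y c ≤ n}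

/-- CONTACT-SOUP CRITERION (engine of the shell line; a LOCAL statement at `p_c`, no reference to
`I_p`): with probability `> 1 - σ`, inside `cube 0 (3n)` the level-`p_c` clusters that are BOUNDED
(diameter in `[ℓ, K ℓ]`, hence finite and automatically disjoint from every infinite cluster) and
meet `cube 0 n`, linked whenever two of them share `≥ M` lattice edges, form ONE linked family
containing a cluster meeting `cube 0 n` and a cluster meeting the complement of `cube 0 (2n)`.
(Sprinkling the `(p, p_c+ε]`-labels then opens each multiplicity-`≥ M` contact with probability
`≥ 1 - (1-ε)^M`, independently given the level-`p` configuration.) -/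
def ContactSoupCriterion (σ : ℝ) : Prop :=
  ∀ M : ℕ, ∃ ℓ K n : ℕ, 1 ≤ ℓ ∧ ℓ * K ≤ n ∧
    ENNReal.ofReal (1 - σ) <
      bondPercolation G3 (criticalProbI 3)
        {ω | ∃ F : Set (Set (Fin 3 → ℤ)),
            (∀ C ∈ F, ∃ x ∈ cube 0 (3 * n), C = openCluster ω x ∧
                (∃ a ∈ C, ∃ b ∈ C, (ℓ : ℤ) ≤ supDist a b) ∧ (∀ a ∈ C, ∀ b ∈ C, supDist a b ≤ ℓ * K)) ∧
            (∃ C ∈ F, ∃ x ∈ C, x ∈ cube 0 n) ∧ (∃ C ∈ F, ∃ x ∈ C, x ∉ cube 0 (2 * n)) ∧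
            (∀ C ∈ F, ∀ D ∈ F, Relation.ReflTransGen
                (fun A B : Set (Fin 3 → ℤ) => A ∈ F ∧ B ∈ F ∧
                  M ≤ Set.ncard {e : Sym2 (Fin 3 → ℤ) | e ∈ G3.edgeSet ∧ (∃ a ∈ e, a ∈ A) ∧ (∃ b ∈ e, b ∈ B) ∧ A ≠ B})
                C D)}

/-- The shell line in one implication: identity + contact soup at every multiplicity ⇒ crux. -/
def ShellLine (σ : ℝ) : Prop :=
  ShellIdentity → ContactSoupCriterion σ → Theses.PercBurnResprinkle.VacantReignition

/-! ## Card `porosity-not-counting` -/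

/-- The `R`-arm set of a configuration: vertices joined by an open path to sup-distance `≥ R`
(a `2R+2`-dependent superset of the union of the infinite clusters). -/
def armSet (R : ℕ) (ω : BondConfig (Fin 3 → ℤ)) : Set (Fin 3 → ℤ) :=
  {y | ∃ z ∈ openCluster ω y, (R : ℤ) ≤ supDist z y}

/-- `w`-fattening in sup-distance. -/
def fatten (w : ℕ) (S : Set (Fin 3 → ℤ)) : Set (Fin 3 → ℤ) := {y | ∃ z ∈ S, supDist z y ≤ w}

/-- Lattice connection `x ↔ y` through vertices of `S` only (all lattice edges available):
the library event `openConnIn S x y` evaluated at the all-open configuration. -/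
def latticeConnIn (S : Set (Fin 3 → ℤ)) (x y : Fin 3 → ℤ) : Prop :=
  (G3.edgeSet : BondConfig (Fin 3 → ℤ)) ∈ openConnIn S x y

/-- POROUS block (Antal–Pisztora-type block event for the VACANT set) at scale `n`, arm range
`R`, resolution `w`, centre `c`: with `K = fatten w (armSet R ω)` and `V = cube c (4n) ∖ K`,
(E) some lattice-connected `D ⊆ V` joins the inner cube `cube c n` to sup-distance `4n`, and
(U) any two lattice-connected subsets of `V` of sup-diameter `≥ n` meeting `cube c (2n)` are
joined inside `V`.  Failure of (U) says `K` contains a LOCAL SEPARATING SHEET at resolution `w`;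
an arm of `K` crossing the block costs nothing — sheets, not arm COUNTS, are the currency. -/
def Porous (c : Fin 3 → ℤ) (n R w : ℕ) (ω : BondConfig (Fin 3 → ℤ)) : Prop :=
  let K := fatten w (armSet R ω)
  let V := cube c (4 * n) \ K
  (∃ D : Set (Fin 3 → ℤ), D ⊆ V ∧ (G3.induce D).Connected ∧
      (∃ x ∈ D, x ∈ cube c n) ∧ (∃ z ∈ D, (4 * n : ℤ) ≤ supDist z c)) ∧
  (∀ D D' : Set (Fin 3 → ℤ), D ⊆ V → D' ⊆ V → (G3.induce D).Connected → (G3.induce D').Connected →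
      (∃ a ∈ D, ∃ b ∈ D, (n : ℤ) ≤ supDist a b) → (∃ a ∈ D', ∃ b ∈ D', (n : ℤ) ≤ supDist a b) →
      (∃ a ∈ D, a ∈ cube c (2 * n)) → (∃ a ∈ D', a ∈ cube c (2 * n)) →
      ∃ x ∈ D, ∃ y ∈ D', latticeConnIn V x y)

/-- Non-porous = the block-scale bad event of the porosity line. It depends only on edges inside
`cube c (4n + w + R + 1)`: LOCAL, hence its `P_p`-probability is a polynomial in `p` and the
criterion below at `p_c` persists for `p ∈ [p_c, p_c + δ]`. -/
def NonPorous (c : Fin 3 → ℤ) (n R w : ℕ) (ω : BondConfig (Fin 3 → ℤ)) : Prop :=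
  ¬ Porous c n R w ω

/-- POROSITY CRITERION at `p_c` (one local inequality per resolution `w`; each is a finite
computation, continuous in `p`, hence stable under `p ↓ p_c`). -/
def PorosityCriterion (σ : ℝ) : Prop :=
  ∀ w : ℕ, ∃ n R : ℕ, w ≤ R ∧ R ≤ n ∧
    bondPercolation G3 (criticalProbI 3) {ω | NonPorous 0 n R w ω} < ENNReal.ofReal σ

/-- FIRST LEMMA of the porosity line (the reduction theorem, provable with present tools for an
explicit `σ`, e.g. any `σ` with `2 σ < 1 - 0.8639`, via porous super-blocks in a coarse PLANE and
the Balister–Bollobás–Walters 1-independent bond criterion, plus a tube lemma for the fresh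
supercritical field): porosity at every resolution ⇒ the crux. -/
def PorosityReduction (σ : ℝ) : Prop :=
  PorosityCriterion σ → Theses.PercBurnResprinkle.VacantReignition

end

end Summit.CriticalPhenomena.PercolationContinuityZ3.Cruxes.VacantReignition.Sketch
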